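import Summits.Ventures.Crystal3D.Theorems.StickyWulffConstantPolycrystalWulffBoundBondMirror
import Summits.Ventures.Crystal3D.Theorems.StickyWulffConstantPolycrystalWulffBoundTwinSectionShiftSlabHolds

/-!
# A single-axis colony has a COMMON horizontal nearest-neighbour bond
# (`PolycrystalWulffBound`, line `PolyDensity`, crux `stmt-Ventures-19482`)

Route `StickyWulffConstant` of the venture `Summits/Ventures/Crystal3D`, second prover lane (poly-p2,
gen 10).  The single-axis rungs (`rung_singleAxis_cells`, `rung_singleAxis_texture(_of_charge)`) take a
unit vector `u ⊥ m` lying in EVERY grain's lattice.  For frames pairwise satisfying the crux's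
co-axiality clause `Ax m` such a common bond exists (`exists_common_horizontal_bond`): the horizontal
unit vectors of every grain's lattice are the image of the half hexagon `½H` under the frame `L` of any
witnessing Barlow stacking (unit differences of a Barlow stacking at equal height are hexagon vectors,
`touching_barlowStacking_eq_image_barlowShell` + `mem_hexagonSet_of_apply_two_eq_zero`), and each grain
realises all six of them (its own cubic frame, a counting argument on the finite set `½H`); two grains
of one clause `Ax m A_f A_g` share `L`, hence share their horizontal bonds.  With `…BondMirror` the
lattice hypotheses of the single-axis rungs reduce to `∀ f g, Ax m (A f) (A g)`.
WHAT THIS IS NOT: anything about energies; the crux is not claimed.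
-/

noncomputable section

open scoped BigOperators InnerProductSpace
open Set

namespace Summit.Ventures.Crystal3D.Theorems

open Summit.Ventures.Crystal3D.Cruxes.TextureLiminf.TexShadow (E3)
open Literature.MathematicalPhysics.StatisticalMechanics (fccStacking barlowStacking barlowPos IsHaggSeq fccHost
  barlowShell barlowShell_one_neg_one_eq touching_barlowStacking_eq_image_barlowShell mem_barlowShell_iff
  mem_hexagonSet_of_apply_two_eq_zero triangularVec₁ zero_mem_fccHost)
open Literature.Geometry.DiscreteGeometry (hexagonSet hexagonSet_subset_layerShell apply_two_of_mem_hexagonSet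
  hexagonSet_eq_uv)

/-- The half hexagon `½H`: the six horizontal unit vectors of the reference lattice. -/
private theorem halfHex_subset_shell :
    (fun x : E3 => (2 : ℝ)⁻¹ • x) '' hexagonSet ⊆
      {w : E3 | w ∈ fccStacking 1 (Real.sqrt (2 / 3)) ∧ ‖w‖ = 1} := by
  rintro _ ⟨x, hx, rfl⟩
  have hmem : (2 : ℝ)⁻¹ • x ∈ barlowShell 1 (-1) := ⟨x, hexagonSet_subset_layerShell 1 (-1) hx, rfl⟩
  have h := barlowShell_one_neg_one_eq ▸ hmem
  exact h

/-- The half hexagon is horizontal. -/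
private theorem halfHex_apply_two {y : E3} (hy : y ∈ (fun x : E3 => (2 : ℝ)⁻¹ • x) '' hexagonSet) :
    y 2 = 0 := by
  obtain ⟨x, hx, rfl⟩ := hy
  simp [apply_two_of_mem_hexagonSet hx]

/-- The half hexagon is a finite set. -/
private theorem halfHex_finite : ((fun x : E3 => (2 : ℝ)⁻¹ • x) '' hexagonSet).Finite := by
  refine Set.Finite.image _ ?_
  rw [hexagonSet_eq_uv]
  exact Set.toFinite _

/-- **Unit differences at equal height in a Barlow stacking are half-hexagon vectors.** -/
theorem sub_mem_halfHex_of_barlowStacking {σ : ℤ → ℤ} (hσ : IsHaggSeq σ) {p q : E3}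
    (hp : p ∈ barlowStacking 1 (Real.sqrt (2 / 3)) σ) (hq : q ∈ barlowStacking 1 (Real.sqrt (2 / 3)) σ)
    (hd : dist q p = 1) (h2 : (q - p) 2 = 0) :
    q - p ∈ (fun x : E3 => (2 : ℝ)⁻¹ • x) '' hexagonSet := by
  obtain ⟨k, i, j, rfl⟩ := hp
  have hmem : q ∈ {x | x ∈ barlowStacking 1 (Real.sqrt (2 / 3)) σ ∧
      dist x (barlowPos 1 (Real.sqrt (2 / 3)) σ k i j) = 1} := ⟨hq, hd⟩
  rw [touching_barlowStacking_eq_image_barlowShell hσ k i j] at hmem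
  obtain ⟨v, hv, hvq⟩ := hmem
  have hvq' : q - barlowPos 1 (Real.sqrt (2 / 3)) σ k i j = v := by
    rw [← hvq, add_sub_cancel_left]
  rw [hvq'] at h2 ⊢
  rw [mem_barlowShell_iff] at hv
  have h2' : ((2 : ℝ) • v) 2 = 0 := by simp [h2]
  have hhex := mem_hexagonSet_of_apply_two_eq_zero hv h2'
  refine ⟨(2 : ℝ) • v, hhex, ?_⟩
  show (2 : ℝ)⁻¹ • ((2 : ℝ) • v) = v
  rw [smul_smul]; norm_num

/-- **Horizontal unit vectors of a lattice inside a framed Barlow stacking come from `L(½H)`.** -/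
theorem horizontal_unit_mem_image_halfHex {L : E3 ≃ₗᵢ[ℝ] E3} {m s : E3} {σ : ℤ → ℤ} (hσ : IsHaggSeq σ)
    (hLm : L (EuclideanSpace.single (2 : Fin 3) (1 : ℝ)) = m) {S : Set E3} (h0 : (0 : E3) ∈ S)
    (hS : S ⊆ (fun q => L q + s) '' barlowStacking 1 (Real.sqrt (2 / 3)) σ)
    {h : E3} (hh : h ∈ S) (hh1 : ‖h‖ = 1) (hhm : ⟪h, m⟫_ℝ = 0) :
    h ∈ L '' ((fun x : E3 => (2 : ℝ)⁻¹ • x) '' hexagonSet) := by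
  obtain ⟨p, hp, hp0⟩ := hS h0
  obtain ⟨q, hq, hqh⟩ := hS hh
  have hp0' : L p + s = 0 := hp0
  have hqh' : L q + s = h := hqh
  have hqp : L (q - p) = h := by
    rw [map_sub]
    calc L q - L p = (L q + s) - (L p + s) := by abel
      _ = h := by rw [hqh', hp0', sub_zero]
  refine ⟨q - p, ?_, hqp⟩
  refine sub_mem_halfHex_of_barlowStacking hσ hp hq ?_ ?_
  · rw [dist_eq_norm, ← LinearIsometryEquiv.norm_map L, hqp, hh1]
  · have : (q - p) 2 = ⟪q - p, EuclideanSpace.single (2 : Fin 3) (1 : ℝ)⟫_ℝ := by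
      rw [EuclideanSpace.inner_single_right]; simp
    rw [this, ← LinearIsometryEquiv.inner_map_map L, hqp, hLm, hhm]

/-- **Every grain realises all six horizontal bonds of its witnessing stacking.**  If `A '' Λ₀`
satisfies the self-clause of `Ax m` with frame `L` (any witness), then `L(½H) ⊆ A '' Λ₀`. -/
theorem image_halfHex_subset_lattice {A L : E3 ≃ₗᵢ[ℝ] E3} {m s : E3} {σ : ℤ → ℤ} (hσ : IsHaggSeq σ)
    (hLm : L (EuclideanSpace.single (2 : Fin 3) (1 : ℝ)) = m)
    (hS : A '' fccStacking 1 (Real.sqrt (2 / 3)) ⊆ (fun q => L q + s) '' barlowStacking 1 (Real.sqrt (2 / 3)) σ)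
    (hAx : ∃ (L' : E3 ≃ₗᵢ[ℝ] E3) (s₁ s₂ : E3) (σ₁ σ₂ : ℤ → ℤ), IsHaggSeq σ₁ ∧ IsHaggSeq σ₂ ∧
      L' (EuclideanSpace.single (2 : Fin 3) (1 : ℝ)) = m ∧
      A '' fccStacking 1 (Real.sqrt (2 / 3)) ⊆
        (fun q => L' q + s₁) '' barlowStacking 1 (Real.sqrt (2 / 3)) σ₁ ∧
      A '' fccStacking 1 (Real.sqrt (2 / 3)) ⊆
        (fun q => L' q + s₂) '' barlowStacking 1 (Real.sqrt (2 / 3)) σ₂) :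
    L '' ((fun x : E3 => (2 : ℝ)⁻¹ • x) '' hexagonSet) ⊆ A '' fccStacking 1 (Real.sqrt (2 / 3)) := by
  classical
  set Hx : Set E3 := (fun x : E3 => (2 : ℝ)⁻¹ • x) '' hexagonSet with hHx
  -- the grain's own frame `M` (with `M e₂ = ±m`)
  obtain ⟨M, -, hAM, hMm⟩ := exists_frame_cruxWulffBody_lattice (m := m) (A := A) hAx
  have hm1 : ‖m‖ = 1 := by rw [← hLm, LinearIsometryEquiv.norm_map, PiLp.norm_single, norm_one]
  -- `M(½H)` consists of horizontal unit vectors of `A Λ₀`, hence lies in `L(½H)`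
  have h0 : (0 : E3) ∈ A '' fccStacking 1 (Real.sqrt (2 / 3)) :=
    ⟨0, zero_mem_fccHost, map_zero A⟩
  have hMsub : M '' Hx ⊆ L '' Hx := by
    rintro _ ⟨y, hy, rfl⟩
    have hy1 : ‖y‖ = 1 := (halfHex_subset_shell hy).2
    have hyΛ : M y ∈ A '' fccStacking 1 (Real.sqrt (2 / 3)) := by
      rw [hAM]; exact ⟨y, (halfHex_subset_shell hy).1, rfl⟩
    refine horizontal_unit_mem_image_halfHex hσ hLm h0 hS hyΛ
      (by rw [LinearIsometryEquiv.norm_map, hy1]) ?_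
    have hye : ⟪y, EuclideanSpace.single (2 : Fin 3) (1 : ℝ)⟫_ℝ = 0 := by
      rw [EuclideanSpace.inner_single_right]; simp [halfHex_apply_two hy]
    rcases hMm with hM | hM
    · rw [← hM, LinearIsometryEquiv.inner_map_map, hye]
    · have : m = -M (EuclideanSpace.single (2 : Fin 3) (1 : ℝ)) := by rw [hM, neg_neg]
      rw [this, inner_neg_right, LinearIsometryEquiv.inner_map_map, hye, neg_zero]
  -- counting: `L⁻¹ ∘ M` maps the finite set `½H` injectively into itself, hence onto
  have hfin : Hx.Finite := halfHex_finite
  set Φ : E3 → E3 := fun x => L.symm (M x) with hΦ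
  have hΦinj : Function.Injective Φ := fun x y hxy => M.injective (L.symm.injective hxy)
  have hΦsub : Φ '' Hx ⊆ Hx := by
    rintro _ ⟨y, hy, rfl⟩
    obtain ⟨z, hz, hzy⟩ := hMsub ⟨y, hy, rfl⟩
    have : Φ y = z := by rw [hΦ]; simp only; rw [← hzy, LinearIsometryEquiv.symm_apply_apply]
    rw [this]; exact hz
  have hΦeq : Φ '' Hx = Hx :=
    Set.eq_of_subset_of_ncard_le hΦsub (by rw [Set.ncard_image_of_injective _ hΦinj]) hfin
  -- conclude
  rintro _ ⟨y, hy, rfl⟩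
  have hy' : y ∈ Φ '' Hx := by rw [hΦeq]; exact hy
  obtain ⟨z, hz, hzy⟩ := hy'
  have : L y = M z := by
    rw [← hzy, hΦ]; simp only; rw [LinearIsometryEquiv.apply_symm_apply]
  rw [this, hAM]
  exact ⟨z, (halfHex_subset_shell hz).1, rfl⟩

/-- **A single-axis colony has a common horizontal nearest-neighbour bond**: if the frames are
pairwise co-axial about `m` (crux clause `Ax m`), there is a unit vector `u ⊥ m` lying in every
grain's lattice `A_f '' Λ₀`. -/
theorem exists_common_horizontal_bond {k : ℕ} (A : Fin k → (E3 ≃ₗᵢ[ℝ] E3)) {m : E3}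
    (hAx : ∀ f g, ∃ (L : E3 ≃ₗᵢ[ℝ] E3) (s₁ s₂ : E3) (σ σ' : ℤ → ℤ), IsHaggSeq σ ∧ IsHaggSeq σ' ∧
      L (EuclideanSpace.single (2 : Fin 3) (1 : ℝ)) = m ∧
      A f '' fccStacking 1 (Real.sqrt (2 / 3)) ⊆
        (fun q => L q + s₁) '' barlowStacking 1 (Real.sqrt (2 / 3)) σ ∧
      A g '' fccStacking 1 (Real.sqrt (2 / 3)) ⊆
        (fun q => L q + s₂) '' barlowStacking 1 (Real.sqrt (2 / 3)) σ')
    (f₀ : Fin k) :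
    ∃ u : E3, ‖u‖ = 1 ∧ ⟪u, m⟫_ℝ = 0 ∧ ∀ f, u ∈ A f '' fccStacking 1 (Real.sqrt (2 / 3)) := by
  -- the bond: `u := L₀ (½ 𝐮)` for the frame `L₀` of the clause `Ax m (A f₀) (A f₀)`
  obtain ⟨L₀, s₁, -, σ, -, hσ, -, hL₀m, hS₀, -⟩ := hAx f₀ f₀
  set y₀ : E3 := (2 : ℝ)⁻¹ • triangularVec₁ (2 : ℝ) with hy₀
  have hy₀H : y₀ ∈ (fun x : E3 => (2 : ℝ)⁻¹ • x) '' hexagonSet :=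
    ⟨triangularVec₁ 2, by rw [hexagonSet_eq_uv]; simp, rfl⟩
  refine ⟨L₀ y₀, ?_, ?_, fun f => ?_⟩
  · rw [LinearIsometryEquiv.norm_map]; exact (halfHex_subset_shell hy₀H).2
  · rw [← hL₀m, LinearIsometryEquiv.inner_map_map, EuclideanSpace.inner_single_right]
    simp [halfHex_apply_two hy₀H]
  · -- the clause `Ax m (A f₀) (A f)` shares one frame `L` between the two grains
    obtain ⟨L, t₁, t₂, σ₁, σ₂, hσ₁, hσ₂, hLm, hS₁, hS₂⟩ := hAx f₀ f
    have h0 : (0 : E3) ∈ A f₀ '' fccStacking 1 (Real.sqrt (2 / 3)) :=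
      ⟨0, zero_mem_fccHost, map_zero (A f₀)⟩
    -- `u ∈ A f₀ Λ₀` (grain `f₀` realises `L₀(½H)`), hence `u ∈ L(½H)` (horizontal unit vector)
    have hu₀ : L₀ y₀ ∈ A f₀ '' fccStacking 1 (Real.sqrt (2 / 3)) :=
      image_halfHex_subset_lattice hσ hL₀m hS₀ (hAx f₀ f₀) ⟨y₀, hy₀H, rfl⟩
    have huL : L₀ y₀ ∈ L '' ((fun x : E3 => (2 : ℝ)⁻¹ • x) '' hexagonSet) := by
      refine horizontal_unit_mem_image_halfHex hσ₁ hLm h0 hS₁ hu₀ ?_ ?_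
      · rw [LinearIsometryEquiv.norm_map]; exact (halfHex_subset_shell hy₀H).2
      · rw [← hL₀m, LinearIsometryEquiv.inner_map_map, EuclideanSpace.inner_single_right]
        simp [halfHex_apply_two hy₀H]
    -- grain `f` realises `L(½H)`
    exact image_halfHex_subset_lattice hσ₂ hLm hS₂ (hAx f f) huL

end Summit.Ventures.Crystal3D.Theorems

end
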